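import Summits.CriticalPhenomena.PercolationContinuityZ3.Theorems.Transplant.SkelPhiParaCorridorKG
import HarnessLib

/-!
# N2 (frames-only node `SamePDropOfSkeletonFrm₁`, OPEN), LEVEL 1, (C) column: THE RUN-FRAME READINGS OF THE THREE PHASES OF THE K-G CORRIDOR —
# in the ONE frame `runX φ c₀ n h σ`: the widened E-run (origin `0`), the ACROSS-parking rendered on axis `1` with an origin `c`, the ALONG-parking on
# axis `0` with an origin `c` (SkelPhiParaParkChain's readings p340144 are the case `c = 0` / the y′-frame; here the origin is a parameter and the
# y′-phase is read in x-frame coordinates — `runY = swap ∘ runX`, SkelPhiParaRunFrame :81–:86)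

For each phase: membership in the `R′`-enlarged core / region / core in parking coordinates relative to the origin, then the three vertex readings
the (S0) kit clause consumes per contact — LINK (`w ∈ pgramPrism t n h (3ℓ) R ⟹ runX w ∈ region k`), LANDING of the steered piece of a non-far centre
(`⟹ runX w ∈ core (k+1)`), and (parking phases) PARKING of a far centre's zone box (`w ∈ cylBall t kz Rk`, `kz + 1 ≤ ρ ⟹ runX w ∈ core (k+1)`).
builds on p205010 (kernel theorem, internal audit signed; external expert review pending) — nothing in this file uses p205010; nothing here is a
claim about the open node `SamePDropOfSkeletonFrm₁`.
Lane `prim-bschramm`, seat `prim-bschramm-p5` (gen 15; (C) lineage; (R-22) K-G); helper file (`--supports stmt-CriticalPhenomena-4575`).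
* §1 run phase (`xRunPrmB`): `runB_mem_region_of_link`, `runB_mem_core_succ_of_piece`;
* §2 along-parking with origin (`xParkPrmW`, axis `0`, origin `c`): `mem_xParkC_enl/region/core_iff`, `xParkC_mem_region_of_link`,
  `xParkC_mem_core_succ_of_piece`, `xParkC_mem_core_succ_of_far`;
* §3 across-parking in x-frame coordinates (`yParkPrmW`, axis `oth 0`, origin `c`): `mem_yParkC_enl/region/core_iff`, `yParkC_mem_region_of_link`,
  `yParkC_mem_core_succ_of_piece` (top pieces `pgTopPieceW … σ τ v`), `yParkC_mem_core_succ_of_far`.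
[cite: KozmaNitzan2024, §4 Lemma 11 (pp. 22–23), Lemma 12 (pp. 23–25)] [cite: MartineauTassion2017, §3.2 Lemma 3.5, §4.3 Lemma 4.2 (arXiv:1312.1946 pp. 12–14)]
-/

noncomputable section

namespace Summit.CriticalPhenomena.PercolationContinuityZ3.Theorems.Transplant

namespace Skelφ

open Literature.Probability.Percolation Literature.Probability.LatticeModels SimpleGraph
open Literature.Probability.Percolation.KozmaNitzan.Cells (oth)
open ChainPlanar ChainPara

variable {V : Type} {G : SimpleGraph V} {φ : V → Site 2}

/-- `oth 1 = 0`. [folklore] -/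
private theorem oth_one' : oth (1 : Fin 2) = 0 := by decide

/-! ## §1 The widened E-run (origin `0`) -/

section RunB

variable (n ℓ : ℕ) (h : ℤ) (R' q W N : ℕ)

/-- The widened E-run schedule (axis `0`, sign `1`, origin `0`). [this work] -/
abbrev xRunSchedB : ScheduleN :=
  (xRunPrmB n ℓ h R' q W N).scheduleN 0 (σ := 1) (Or.inl rfl) 0 (xRunPrmB_ok n ℓ h R' q W N) (xRunPrmB_eb n ℓ h R' q W N)

variable {n ℓ h R' q W N}

/-- **LINK (run phase)**: `runX t` in the enlarged core `k` and `w ∈ pgramPrism t n h (3ℓ) R` give `runX w ∈ region k`. [cite: KozmaNitzan2024, §4 Lemma 11 (p. 22)] -/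
theorem runB_mem_region_of_link (hn : 1 ≤ n) (c₀ : V) {σ : ℤ} (hσ : σ = 1 ∨ σ = -1) {k : ℕ} {t w : V} {R : ℕ}
    (ht : runX φ c₀ n h σ t ∈ Finset.Icc ((xRunSchedB n ℓ h R' q W N).lo k - (((xRunSchedB n ℓ h R' q W N).R' : ℕ) : Site 2))
      ((xRunSchedB n ℓ h R' q W N).hi k + (((xRunSchedB n ℓ h R' q W N).R' : ℕ) : Site 2)))
    (hw : w ∈ pgramPrism G φ t n h (3 * ℓ) R) : runX φ c₀ n h σ w ∈ (xRunSchedB n ℓ h R' q W N).region k := by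
  have ht' := (mem_scheduleN_enl_iff (xRunPrmB_ok n ℓ h R' q W N) (xRunPrmB_eb n ℓ h R' q W N)).1 ht
  obtain ⟨h0, h1⟩ := link_runX hn c₀ h hσ hw R' q N
  exact (mem_scheduleN_region_iff _ _).2 (RunPrm.inRegion_of_link ht' h0 h1)

/-- **LANDING (run phase)**: with `τₖ := steer k (runX t 1)` of the widened run, every `w ∈ pgSideHalfW t n h ℓ R σ (σ·τₖ)` has `runX w ∈ core (k+1)`.
[cite: MartineauTassion2017, §4.3 Lemma 4.2] [cite: KozmaNitzan2024, §4 Lemma 11 (pp. 22–23)] -/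
theorem runB_mem_core_succ_of_piece [G.LocallyFinite] (hn : 1 ≤ n) (c₀ : V) {σ : ℤ} (hσ : σ = 1 ∨ σ = -1) {k : ℕ} {t w : V} {R : ℕ}
    (ht : runX φ c₀ n h σ t ∈ Finset.Icc ((xRunSchedB n ℓ h R' q W N).lo k - (((xRunSchedB n ℓ h R' q W N).R' : ℕ) : Site 2))
      ((xRunSchedB n ℓ h R' q W N).hi k + (((xRunSchedB n ℓ h R' q W N).R' : ℕ) : Site 2)))
    (hw : w ∈ pgSideHalfW G φ t n h ℓ R σ (σ * (xRunPrmB n ℓ h R' q W N).steer k (runX φ c₀ n h σ t 1))) :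
    runX φ c₀ n h σ w ∈ (xRunSchedB n ℓ h R' q W N).core (k + 1) := by
  set τ₀ := (xRunPrmB n ℓ h R' q W N).steer k (runX φ c₀ n h σ t 1) with hτ₀
  have hτ₀' : τ₀ = 1 ∨ τ₀ = -1 := (xRunPrmB n ℓ h R' q W N).steer_eq_or k _
  have hστ : σ * τ₀ = 1 ∨ σ * τ₀ = -1 := by
    rcases hσ with rfl | rfl <;> rcases hτ₀' with h1 | h1 <;> simp [h1]
  have hσσ : σ * σ = 1 := by rcases hσ with h1 | h1 <;> simp [h1]
  have ht' := (mem_scheduleN_enl_iff (xRunPrmB_ok n ℓ h R' q W N) (xRunPrmB_eb n ℓ h R' q W N)).1 ht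
  obtain ⟨h0, hpc⟩ := landing_runX_W hn c₀ h hσ hστ hw R' q N
  have hpiece : (xRunPrmB n ℓ h R' q W N).InPiece τ₀ (runX φ c₀ n h σ w 1 - runX φ c₀ n h σ t 1 - (xRunPrmB n ℓ h R' q W N).d) := by
    have e : σ * (σ * τ₀) = τ₀ := by rw [← mul_assoc, hσσ, one_mul]
    rw [e] at hpc; exact hpc
  refine (mem_scheduleN_core_iff _ _).2 (RunPrm.inCore_succ_of_landing (xRunPrmB_ok n ℓ h R' q W N) ht' ?_ ?_ hpiece)
  · rw [h0]; exact le_rfl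
  · rw [h0]; exact le_rfl

end RunB

/-! ## §2 The along-parking with an origin (axis `0`) -/

section XParkC

variable {n ℓ : ℕ} {h : ℤ} {R' ρ : ℕ} {aLo0 A : ℤ} {Wm Wp N : ℕ} (hP : ParkOK (xParkPrmW n ℓ h R' ρ aLo0 A Wm Wp N)) (c : Site 2)

/-- The along-parking schedule with origin `c` (axis `0`, sign `1`). [this work] -/
abbrev xParkSchedC : ScheduleNP :=
  (xParkPrmW n ℓ h R' ρ aLo0 A Wm Wp N).scheduleNP 0 (σ := 1) (Or.inl rfl) c hP (xParkPrmW_eb n ℓ h R' ρ aLo0 A Wm Wp N)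

/-- Membership in the `R′`-enlarged core `k`, relative to the origin. [folklore] -/
theorem mem_xParkC_enl_iff {k : ℕ} {y : Site 2} :
    y ∈ Finset.Icc ((xParkSchedC hP c).lo k - (((xParkSchedC hP c).R' : ℕ) : Site 2)) ((xParkSchedC hP c).hi k + (((xParkSchedC hP c).R' : ℕ) : Site 2)) ↔
      (xParkPrmW n ℓ h R' ρ aLo0 A Wm Wp N).InEnl k (y 0 - c 0) (y 1 - c 1) := by
  show y ∈ Finset.Icc (dLo 0 1 c _ _ _ _ - (((xParkPrmW n ℓ h R' ρ aLo0 A Wm Wp N).ea : ℕ) : Site 2))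
      (dHi 0 1 c _ _ _ _ + (((xParkPrmW n ℓ h R' ρ aLo0 A Wm Wp N).ea : ℕ) : Site 2)) ↔ _
  rw [dBox_enlarge (Or.inl rfl), ParkPrm.mem_enlarge_iff (Or.inl rfl) (xParkPrmW_eb n ℓ h R' ρ aLo0 A Wm Wp N)]
  simp [oth_zero]

/-- Membership in region `k`, relative to the origin. [folklore] -/
theorem mem_xParkC_region_iff {k : ℕ} {y : Site 2} :
    y ∈ (xParkSchedC hP c).region k ↔ (xParkPrmW n ℓ h R' ρ aLo0 A Wm Wp N).InRegion k (y 0 - c 0) (y 1 - c 1) := by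
  show y ∈ (xParkPrmW n ℓ h R' ρ aLo0 A Wm Wp N).pregion 0 1 c k ↔ _
  rw [ParkPrm.mem_pregion_iff (Or.inl rfl)]; simp [oth_zero]

/-- Membership in core `k`, relative to the origin. [folklore] -/
theorem mem_xParkC_core_iff {k : ℕ} {y : Site 2} :
    y ∈ (xParkSchedC hP c).core k ↔ (xParkPrmW n ℓ h R' ρ aLo0 A Wm Wp N).InCore k (y 0 - c 0) (y 1 - c 1) := by
  rw [ParkPrm.scheduleNP_core, ParkPrm.mem_pcore_iff (Or.inl rfl)]; simp [oth_zero]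

/-- **LINK (along-parking)**: `runX t` in the enlarged core `k` and `w ∈ pgramPrism t n h (3ℓ) R` give `runX w ∈ region k`. [cite: KozmaNitzan2024, §4 Lemma 11 (p. 22)] -/
theorem xParkC_mem_region_of_link (hn : 1 ≤ n) (c₀ : V) {σ : ℤ} (hσ : σ = 1 ∨ σ = -1) {k : ℕ} {t w : V} {R : ℕ}
    (ht : runX φ c₀ n h σ t ∈ Finset.Icc ((xParkSchedC hP c).lo k - (((xParkSchedC hP c).R' : ℕ) : Site 2))
      ((xParkSchedC hP c).hi k + (((xParkSchedC hP c).R' : ℕ) : Site 2)))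
    (hw : w ∈ pgramPrism G φ t n h (3 * ℓ) R) : runX φ c₀ n h σ w ∈ (xParkSchedC hP c).region k := by
  have ht' := (mem_xParkC_enl_iff hP c).1 ht
  obtain ⟨h0, h1⟩ := link_runX hn c₀ h hσ hw R' 0 0
  refine (mem_xParkC_region_iff hP c).2 (ParkPrm.inRegion_of_link ht' ?_ ?_)
  · rw [sub_sub_sub_cancel_right]; simpa [xPrmW, xParkPrmW] using h0
  · rw [sub_sub_sub_cancel_right]; simpa [xPrmW, xParkPrmW] using h1

/-- **LANDING (along-parking)**: a NON-far centre's steered side half (`τₖ := steer k (runX t 1 − c 1)`) is read into the next core.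
[cite: MartineauTassion2017, §4.3 Lemma 4.2] [cite: KozmaNitzan2024, §4 Lemma 12 (pp. 23–25)] -/
theorem xParkC_mem_core_succ_of_piece [G.LocallyFinite] (hn : 1 ≤ n) (c₀ : V) {σ : ℤ} (hσ : σ = 1 ∨ σ = -1) {k : ℕ} {t w : V} {R : ℕ}
    (ht : runX φ c₀ n h σ t ∈ Finset.Icc ((xParkSchedC hP c).lo k - (((xParkSchedC hP c).R' : ℕ) : Site 2))
      ((xParkSchedC hP c).hi k + (((xParkSchedC hP c).R' : ℕ) : Site 2)))
    (hfar : ¬ (xParkPrmW n ℓ h R' ρ aLo0 A Wm Wp N).IsFar k (runX φ c₀ n h σ t 0 - c 0))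
    (hw : w ∈ pgSideHalfW G φ t n h ℓ R σ (σ * (xParkPrmW n ℓ h R' ρ aLo0 A Wm Wp N).steer k (runX φ c₀ n h σ t 1 - c 1))) :
    runX φ c₀ n h σ w ∈ (xParkSchedC hP c).core (k + 1) := by
  set P := xParkPrmW n ℓ h R' ρ aLo0 A Wm Wp N with hPdef
  set τ₀ := P.steer k (runX φ c₀ n h σ t 1 - c 1) with hτ₀
  have hτ₀' : τ₀ = 1 ∨ τ₀ = -1 := P.steer_eq_or k _
  have hστ : σ * τ₀ = 1 ∨ σ * τ₀ = -1 := by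
    rcases hσ with rfl | rfl <;> rcases hτ₀' with h1 | h1 <;> simp [h1]
  have hσσ : σ * σ = 1 := by rcases hσ with h1 | h1 <;> simp [h1]
  have ht' := (mem_xParkC_enl_iff hP c).1 ht
  obtain ⟨h0, hpc⟩ := landing_runX_W hn c₀ h hσ hστ hw R' 0 0
  have hpiece : P.InPiece τ₀ ((runX φ c₀ n h σ w 1 - c 1) - (runX φ c₀ n h σ t 1 - c 1) - P.d) := by
    have e : σ * (σ * τ₀) = τ₀ := by rw [← mul_assoc, hσσ, one_mul]
    rw [e] at hpc
    rw [sub_sub_sub_cancel_right]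
    simpa [RunPrm.InPiece, ParkPrm.InPiece, xPrmW, xParkPrmW, hPdef] using hpc
  refine (mem_xParkC_core_iff hP c).2 (ParkPrm.inCore_succ_of_landing hP ht' hfar ?_ ?_ hpiece)
  · rw [sub_sub_sub_cancel_right, h0]; exact le_rfl
  · rw [sub_sub_sub_cancel_right, h0]; exact le_rfl

/-- **PARKING (along-parking)**: a FAR centre's zone box `cylBall t kz Rk` (`kz + 1 ≤ ρ`) is read into the next core. [cite: KozmaNitzan2024, §4 Lemma 12 (pp. 23–25)] -/
theorem xParkC_mem_core_succ_of_far (hn : 1 ≤ n) (c₀ : V) {σ : ℤ} (hσ : σ = 1 ∨ σ = -1) {k : ℕ} {t w : V} {kz Rk : ℕ} (hkz : kz + 1 ≤ ρ)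
    (ht : runX φ c₀ n h σ t ∈ Finset.Icc ((xParkSchedC hP c).lo k - (((xParkSchedC hP c).R' : ℕ) : Site 2))
      ((xParkSchedC hP c).hi k + (((xParkSchedC hP c).R' : ℕ) : Site 2)))
    (hfar : (xParkPrmW n ℓ h R' ρ aLo0 A Wm Wp N).IsFar k (runX φ c₀ n h σ t 0 - c 0)) (hw : w ∈ cylBall G φ t kz Rk) :
    runX φ c₀ n h σ w ∈ (xParkSchedC hP c).core (k + 1) := by
  have ht' := (mem_xParkC_enl_iff hP c).1 ht
  have hbox : φ w - φ t ∈ box 2 kz := (mem_cyl φ t kz w).1 (cylBall_subset_cyl G φ t kz Rk hw)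
  have hσ1 : |σ| = 1 := by rcases hσ with rfl | rfl <;> simp
  have h0 : |(runX φ c₀ n h σ w 0 - c 0) - (runX φ c₀ n h σ t 0 - c 0)| ≤ (xParkPrmW n ℓ h R' ρ aLo0 A Wm Wp N).ρ := by
    rw [sub_sub_sub_cancel_right, runX_sub_runX_zero, abs_mul, hσ1, one_mul]
    have := abs_relCoord_le_of_box hbox 0
    simp only [xParkPrmW]; omega
  have h1 : |(runX φ c₀ n h σ w 1 - c 1) - (runX φ c₀ n h σ t 1 - c 1)| ≤ (xParkPrmW n ℓ h R' ρ aLo0 A Wm Wp N).ρ := by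
    rw [sub_sub_sub_cancel_right]
    have hβ := abs_shearCoord_le_of_box hbox n h
    have h2 := abs_runX_sub_runX_one_le hn φ c₀ h hσ t w hβ
    have hU := shearUnit_pos hn h
    have e : ((shearUnit n h : ℤ) * kz) / (shearUnit n h : ℤ) = kz := by
      rw [mul_comm]; exact Int.mul_ediv_cancel _ hU.ne'
    rw [e] at h2
    simp only [xParkPrmW]; omega
  exact (mem_xParkC_core_iff hP c).2 (ParkPrm.box_subset_of_isFar ht' hfar h0 h1)

end XParkC

/-! ## §3 The across-parking in x-frame coordinates (axis `oth 0`, origin `c`) -/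

section YParkC

variable {n ℓ : ℕ} {h v : ℤ} {R' ρ : ℕ} {aLo0 A : ℤ} {Wm Wp N : ℕ} (hP : ParkOK (yParkPrmW n ℓ h v R' ρ aLo0 A Wm Wp N)) (c : Site 2)

/-- The across-parking schedule rendered on axis `oth 0 = 1` of the x-frame with origin `c` (sign `1`). [this work] -/
abbrev yParkSchedC : ScheduleNP :=
  (yParkPrmW n ℓ h v R' ρ aLo0 A Wm Wp N).scheduleNP (oth 0) (σ := 1) (Or.inl rfl) c hP (yParkPrmW_eb n ℓ h v R' ρ aLo0 A Wm Wp N)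

/-- Membership in the `R′`-enlarged core `k`: along = coordinate `1`, across = coordinate `0`, relative to the origin. [folklore] -/
theorem mem_yParkC_enl_iff {k : ℕ} {y : Site 2} :
    y ∈ Finset.Icc ((yParkSchedC hP c).lo k - (((yParkSchedC hP c).R' : ℕ) : Site 2)) ((yParkSchedC hP c).hi k + (((yParkSchedC hP c).R' : ℕ) : Site 2)) ↔
      (yParkPrmW n ℓ h v R' ρ aLo0 A Wm Wp N).InEnl k (y 1 - c 1) (y 0 - c 0) := by
  show y ∈ Finset.Icc (dLo (oth 0) 1 c _ _ _ _ - (((yParkPrmW n ℓ h v R' ρ aLo0 A Wm Wp N).ea : ℕ) : Site 2))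
      (dHi (oth 0) 1 c _ _ _ _ + (((yParkPrmW n ℓ h v R' ρ aLo0 A Wm Wp N).ea : ℕ) : Site 2)) ↔ _
  rw [dBox_enlarge (Or.inl rfl), ParkPrm.mem_enlarge_iff (Or.inl rfl) (yParkPrmW_eb n ℓ h v R' ρ aLo0 A Wm Wp N)]
  simp [oth_zero, oth_one']

/-- Membership in region `k`, x-frame coordinates relative to the origin. [folklore] -/
theorem mem_yParkC_region_iff {k : ℕ} {y : Site 2} :
    y ∈ (yParkSchedC hP c).region k ↔ (yParkPrmW n ℓ h v R' ρ aLo0 A Wm Wp N).InRegion k (y 1 - c 1) (y 0 - c 0) := by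
  show y ∈ (yParkPrmW n ℓ h v R' ρ aLo0 A Wm Wp N).pregion (oth 0) 1 c k ↔ _
  rw [ParkPrm.mem_pregion_iff (Or.inl rfl)]; simp [oth_zero, oth_one']

/-- Membership in core `k`, x-frame coordinates relative to the origin. [folklore] -/
theorem mem_yParkC_core_iff {k : ℕ} {y : Site 2} :
    y ∈ (yParkSchedC hP c).core k ↔ (yParkPrmW n ℓ h v R' ρ aLo0 A Wm Wp N).InCore k (y 1 - c 1) (y 0 - c 0) := by
  rw [ParkPrm.scheduleNP_core, ParkPrm.mem_pcore_iff (Or.inl rfl)]; simp [oth_zero, oth_one']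

/-- **LINK (across-parking)**: `runX t` in the enlarged core `k` and `w ∈ pgramPrism t n h (3ℓ) R` give `runX w ∈ region k` (the link box of the y′-record
read in x-frame coordinates: along `⌊3nℓ/c⌋ + 1` on coordinate `1`, across `n` on coordinate `0`). [cite: KozmaNitzan2024, §4 Lemma 11 (p. 22)] -/
theorem yParkC_mem_region_of_link (hn : 1 ≤ n) (c₀ : V) {σ : ℤ} (hσ : σ = 1 ∨ σ = -1) {k : ℕ} {t w : V} {R : ℕ}
    (ht : runX φ c₀ n h σ t ∈ Finset.Icc ((yParkSchedC hP c).lo k - (((yParkSchedC hP c).R' : ℕ) : Site 2))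
      ((yParkSchedC hP c).hi k + (((yParkSchedC hP c).R' : ℕ) : Site 2)))
    (hw : w ∈ pgramPrism G φ t n h (3 * ℓ) R) : runX φ c₀ n h σ w ∈ (yParkSchedC hP c).region k := by
  have ht' := (mem_yParkC_enl_iff hP c).1 ht
  obtain ⟨h0, h1⟩ := link_runX hn c₀ h hσ hw R' 0 0
  refine (mem_yParkC_region_iff hP c).2 (ParkPrm.inRegion_of_link ht' ?_ ?_)
  · rw [sub_sub_sub_cancel_right]; simpa [xPrmW, yParkPrmW] using h1
  · rw [sub_sub_sub_cancel_right]; simpa [xPrmW, yParkPrmW] using h0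

/-- **LANDING (across-parking)**: a NON-far centre's steered TOP piece `pgTopPieceW … σ τₖ v` (`τₖ := steer k (runX t 0 − c 0)`, along progress on
coordinate `1` in `[sLo, sHi]`, across offset `σα − v` in the piece) is read into the next core. [cite: MartineauTassion2017, §4.3 Lemma 4.2] [cite: KozmaNitzan2024, §4 Lemma 12] -/
theorem yParkC_mem_core_succ_of_piece [G.LocallyFinite] (hn : 1 ≤ n) (c₀ : V) {σ : ℤ} (hσ : σ = 1 ∨ σ = -1) {k : ℕ} {t w : V} {R : ℕ}
    (ht : runX φ c₀ n h σ t ∈ Finset.Icc ((yParkSchedC hP c).lo k - (((yParkSchedC hP c).R' : ℕ) : Site 2))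
      ((yParkSchedC hP c).hi k + (((yParkSchedC hP c).R' : ℕ) : Site 2)))
    (hfar : ¬ (yParkPrmW n ℓ h v R' ρ aLo0 A Wm Wp N).IsFar k (runX φ c₀ n h σ t 1 - c 1))
    (hw : w ∈ pgTopPieceW G φ t n h ℓ R σ ((yParkPrmW n ℓ h v R' ρ aLo0 A Wm Wp N).steer k (runX φ c₀ n h σ t 0 - c 0)) v) :
    runX φ c₀ n h σ w ∈ (yParkSchedC hP c).core (k + 1) := by
  set P := yParkPrmW n ℓ h v R' ρ aLo0 A Wm Wp N with hPdef
  set τ₀ := P.steer k (runX φ c₀ n h σ t 0 - c 0) with hτ₀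
  have hτ₀' : τ₀ = 1 ∨ τ₀ = -1 := P.steer_eq_or k _
  have ht' := (mem_yParkC_enl_iff hP c).1 ht
  obtain ⟨⟨hlo, hhi⟩, hpc⟩ := landing_runY_W hn c₀ h hσ hτ₀' hw R' 0 0
  rw [runY_zero, runY_zero, ← runX_one φ c₀ n h σ w, ← runX_one φ c₀ n h σ t] at hlo hhi
  rw [runY_one, runY_one, ← runX_zero φ c₀ n h σ w, ← runX_zero φ c₀ n h σ t] at hpc
  have hpiece : P.InPiece τ₀ ((runX φ c₀ n h σ w 0 - c 0) - (runX φ c₀ n h σ t 0 - c 0) - P.d) := by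
    rw [sub_sub_sub_cancel_right]
    simpa [RunPrm.InPiece, ParkPrm.InPiece, yPrmW, yParkPrmW, hPdef] using hpc
  refine (mem_yParkC_core_iff hP c).2 (ParkPrm.inCore_succ_of_landing hP ht' hfar ?_ ?_ hpiece)
  · rw [sub_sub_sub_cancel_right]; simpa [yPrmW, yParkPrmW, hPdef] using hlo
  · rw [sub_sub_sub_cancel_right]; simpa [yPrmW, yParkPrmW, hPdef] using hhi

/-- **PARKING (across-parking)**: a FAR centre's zone box `cylBall t kz Rk` (`kz + 1 ≤ ρ`) is read into the next core. [cite: KozmaNitzan2024, §4 Lemma 12 (pp. 23–25)] -/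
theorem yParkC_mem_core_succ_of_far (hn : 1 ≤ n) (c₀ : V) {σ : ℤ} (hσ : σ = 1 ∨ σ = -1) {k : ℕ} {t w : V} {kz Rk : ℕ} (hkz : kz + 1 ≤ ρ)
    (ht : runX φ c₀ n h σ t ∈ Finset.Icc ((yParkSchedC hP c).lo k - (((yParkSchedC hP c).R' : ℕ) : Site 2))
      ((yParkSchedC hP c).hi k + (((yParkSchedC hP c).R' : ℕ) : Site 2)))
    (hfar : (yParkPrmW n ℓ h v R' ρ aLo0 A Wm Wp N).IsFar k (runX φ c₀ n h σ t 1 - c 1)) (hw : w ∈ cylBall G φ t kz Rk) :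
    runX φ c₀ n h σ w ∈ (yParkSchedC hP c).core (k + 1) := by
  have ht' := (mem_yParkC_enl_iff hP c).1 ht
  have hbox : φ w - φ t ∈ box 2 kz := (mem_cyl φ t kz w).1 (cylBall_subset_cyl G φ t kz Rk hw)
  have hσ1 : |σ| = 1 := by rcases hσ with rfl | rfl <;> simp
  have h1 : |(runX φ c₀ n h σ w 0 - c 0) - (runX φ c₀ n h σ t 0 - c 0)| ≤ (yParkPrmW n ℓ h v R' ρ aLo0 A Wm Wp N).ρ := by
    rw [sub_sub_sub_cancel_right, runX_sub_runX_zero, abs_mul, hσ1, one_mul]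
    have := abs_relCoord_le_of_box hbox 0
    simp only [yParkPrmW]; omega
  have h0 : |(runX φ c₀ n h σ w 1 - c 1) - (runX φ c₀ n h σ t 1 - c 1)| ≤ (yParkPrmW n ℓ h v R' ρ aLo0 A Wm Wp N).ρ := by
    rw [sub_sub_sub_cancel_right]
    have hβ := abs_shearCoord_le_of_box hbox n h
    have h2 := abs_runX_sub_runX_one_le hn φ c₀ h hσ t w hβ
    have hU := shearUnit_pos hn h
    have e : ((shearUnit n h : ℤ) * kz) / (shearUnit n h : ℤ) = kz := by
      rw [mul_comm]; exact Int.mul_ediv_cancel _ hU.ne'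
    rw [e] at h2
    simp only [yParkPrmW]; omega
  exact (mem_yParkC_core_iff hP c).2 (ParkPrm.box_subset_of_isFar ht' hfar h0 h1)

end YParkC

end Skelφ

end Summit.CriticalPhenomena.PercolationContinuityZ3.Theorems.Transplant

end
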